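import Mathlib
import Summits.MatrixMultiplication.MatrixMultiplication.Theses.CongruenceTowerPacking

/-!
# Route CongruenceTowerPacking — the first-order box barrier `AnalyticBoxBarrier`

Support item `stmt-MatrixMultiplication-12344` of route `CongruenceTowerPacking`, proved as stated.

Let `R = ℤ/p^k` with `m < k ≤ 2m` and `π = p^m ∈ R`, so `π² = 0`. Suppose
`S ⊆ g₁(1 + π D₁(R^a))`, `T ⊆ g₂(1 + π D₂(R^b))`, `U ⊆ g₃(1 + π D₃(R^c))` are first-order boxes in
`GL_n(R)` whose conjugated tangents `gᵢ Dᵢ(·) gᵢ⁻¹` lie in the submodule `L ≤ M_n(R)` spanned by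
`d` matrices, and `(S, T, U)` has the triple product property (Cohn–Umans 2003, Def. 2.1, the tree's
`Literature.Combinatorics.Additive.TripleProductProperty`, right quotients `s s'⁻¹`). Then
`|S| |T| |U| ≤ p^((k − m) d)`.

Proof (Cohn–Umans 2003, Lemma 3.1 after right translation, Neumann 2011, Obs. 2.1, written out
element-wise). For `s = g(1 + π y)` put `z = g y g⁻¹ ∈ L`; then `s = (1 + π z) g`,
`s⁻¹ = g⁻¹ (1 − π z)` and, since any two `π`-multiples have product zero,
`s s'⁻¹ = 1 + π (z − z')`. Hence with `N₁ s = s g₁⁻¹ − 1 ∈ π L` (and `N₂`, `N₃` alike)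
`s s'⁻¹ · t t'⁻¹ · u u'⁻¹ = 1 + (N₁ s − N₁ s') + (N₂ t − N₂ t') + (N₃ u − N₃ u')`, so the map
`(s, t, u) ↦ N₁ s + N₂ t + N₃ u` is injective on `S × T × U` by the triple product property, with
image inside `π L = {∑ᵢ π cᵢ genᵢ}`; and `π c` takes at most `p^(k−m)` values (`π c` depends only on
`c.val mod p^(k−m)`), so `|π L| ≤ p^((k−m) d)`.

No named fact is assumed; axioms are the standard three.
-/

-- single-conjunct summit: the mandated namespace `Summit.MatrixMultiplication.MatrixMultiplication.…`
-- repeats `MatrixMultiplication` (summit = sub-problem), which `linter.dupNamespace` would flag.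
set_option linter.dupNamespace false

namespace Summit.MatrixMultiplication.MatrixMultiplication.Theorems

open Literature.Combinatorics.Additive

namespace AnalyticBoxBarrier

section algebra

variable {R A : Type*} [CommRing R] [Ring A] [Algebra R A]

/-- If `π² = 0` in the scalar ring then the product of two `π`-multiples vanishes. -/
theorem smul_mul_smul_eq_zero' {π : R} (hπ : π * π = 0) (x y : A) :
    (π • x) * (π • y) = 0 := by
  rw [smul_mul_smul_comm, hπ, zero_smul]

/-- `(1 + M₁)(1 + M₂)(1 + M₃) = 1 + (M₁ + M₂ + M₃)` when the pairwise products `M₁M₂`, `M₁M₃`, `M₂M₃`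
vanish. -/
theorem one_add_mul_one_add_mul_one_add {M₁ M₂ M₃ : A} (h12 : M₁ * M₂ = 0)
    (h13 : M₁ * M₃ = 0) (h23 : M₂ * M₃ = 0) :
    (1 + M₁) * (1 + M₂) * (1 + M₃) = 1 + (M₁ + M₂ + M₃) := by
  simp only [mul_add, add_mul, mul_one, one_mul, h12, h13, h23, add_zero]
  abel

/-- Tangent of a box element: if `s = g (1 + π y)` then `s g⁻¹ − 1 = π (g y g⁻¹)`. -/
theorem tangent_eq {π : R} (g s : Aˣ) (y : A) (hs : (s : A) = g * (1 + π • y)) :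
    (s : A) * ↑g⁻¹ - 1 = π • ((g : A) * y * ↑g⁻¹) := by
  rw [hs, mul_add, mul_one, add_mul, Units.mul_inv, mul_smul_comm, smul_mul_assoc,
    add_sub_cancel_left]

/-- Box representation: if `s = g (1 + π y)` with `π² = 0` then, with `z = g y g⁻¹`,
`s = (1 + π z) g` and `s⁻¹ = g⁻¹ (1 − π z)`. -/
theorem box_repr {π : R} (hπ : π * π = 0) (g s : Aˣ) (y : A)
    (hs : (s : A) = g * (1 + π • y)) :
    (s : A) = (1 + π • ((g : A) * y * ↑g⁻¹)) * g ∧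
      ((s⁻¹ : Aˣ) : A) = ↑g⁻¹ * (1 - π • ((g : A) * y * ↑g⁻¹)) := by
  have h1 : (s : A) * ↑g⁻¹ = 1 + π • ((g : A) * y * ↑g⁻¹) := by
    rw [hs, mul_add, mul_one, add_mul, Units.mul_inv, mul_smul_comm, smul_mul_assoc]
  refine ⟨by rw [← h1, Units.inv_mul_cancel_right], Units.inv_eq_of_mul_eq_one_right ?_⟩
  rw [← mul_assoc, h1, mul_sub, mul_one, add_mul, one_mul, smul_mul_smul_eq_zero' hπ, add_zero,
    add_sub_cancel_right]

/-- Right quotient of two elements of one box: if `s = g(1 + π y)`, `s' = g(1 + π y')` and `π² = 0`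
then `s s'⁻¹ = 1 + π (g y g⁻¹ − g y' g⁻¹)`. -/
theorem quot_eq {π : R} (hπ : π * π = 0) (g s s' : Aˣ) (y y' : A)
    (hs : (s : A) = g * (1 + π • y)) (hs' : (s' : A) = g * (1 + π • y')) :
    ((s * s'⁻¹ : Aˣ) : A) = 1 + π • ((g : A) * y * ↑g⁻¹ - (g : A) * y' * ↑g⁻¹) := by
  obtain ⟨h1, -⟩ := box_repr hπ g s y hs
  obtain ⟨-, h2⟩ := box_repr hπ g s' y' hs'
  rw [Units.val_mul, h1, h2, mul_assoc, Units.mul_inv_cancel_left, mul_sub, mul_one, add_mul,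
    one_mul, smul_mul_smul_eq_zero' hπ, add_zero, smul_sub, add_sub_assoc]

end algebra

/-- Counting the `π`-multiples of a `d`-generated submodule over `ℤ/p^k`, `π = p^m`, `m ≤ k`: they
all lie in a finite set of size at most `p^((k − m) d)` (namely `{∑ᵢ p^m rᵢ • genᵢ : 0 ≤ rᵢ < p^(k−m)}`,
because `p^m c` only depends on `c.val mod p^(k−m)`). -/
theorem box_count {p k m : ℕ} (hp : p.Prime) (hmk : m ≤ k) {M : Type*} [AddCommGroup M]
    [Module (ZMod (p ^ k)) M] [DecidableEq M] {d : ℕ} (gen : Fin d → M) :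
    ∃ box : Finset M, box.card ≤ p ^ ((k - m) * d) ∧
      ∀ l ∈ Submodule.span (ZMod (p ^ k)) (Set.range gen), ((p : ZMod (p ^ k)) ^ m) • l ∈ box := by
  classical
  haveI : NeZero (p ^ k) := ⟨pow_ne_zero _ hp.ne_zero⟩
  set q : ℕ := p ^ (k - m) with hq
  have hq0 : 0 < q := pow_pos hp.pos _
  have hpq : p ^ m * q = p ^ k := by rw [hq, ← pow_add, Nat.add_sub_cancel' hmk]
  refine ⟨(Fintype.piFinset fun _ : Fin d => Finset.range q).image
      fun r => ∑ i, ((p ^ m * r i : ℕ) : ZMod (p ^ k)) • gen i, ?_, ?_⟩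
  · refine Finset.card_image_le.trans (le_of_eq ?_)
    rw [Fintype.card_piFinset, Finset.prod_const, Finset.card_range, Finset.card_univ,
      Fintype.card_fin, hq, pow_mul]
  · intro l hl
    obtain ⟨cf, rfl⟩ := (Submodule.mem_span_range_iff_exists_fun (ZMod (p ^ k))).mp hl
    rw [Finset.mem_image]
    refine ⟨fun i => (cf i).val % q, ?_, ?_⟩
    · exact Fintype.mem_piFinset.mpr fun i => Finset.mem_range.mpr (Nat.mod_lt _ hq0)
    · rw [Finset.smul_sum]
      refine Finset.sum_congr rfl fun i _ => ?_
      rw [smul_smul]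
      congr 1
      have hv : q * ((cf i).val / q) + (cf i).val % q = (cf i).val := Nat.div_add_mod _ _
      have hnat : p ^ k * ((cf i).val / q) + p ^ m * ((cf i).val % q) = p ^ m * (cf i).val := by
        conv_rhs => rw [← hv]
        rw [mul_add, ← mul_assoc, hpq]
      calc ((p ^ m * ((cf i).val % q) : ℕ) : ZMod (p ^ k))
          = ((p ^ k * ((cf i).val / q) + p ^ m * ((cf i).val % q) : ℕ) : ZMod (p ^ k)) := by
            rw [Nat.cast_add, Nat.cast_mul (p ^ k), ZMod.natCast_self, zero_mul, zero_add]
        _ = ((p ^ m * (cf i).val : ℕ) : ZMod (p ^ k)) := by rw [hnat]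
        _ = (p : ZMod (p ^ k)) ^ m * cf i := by
            rw [Nat.cast_mul, Nat.cast_pow, ZMod.natCast_zmod_val]

end AnalyticBoxBarrier

open AnalyticBoxBarrier in
/-- **The first-order box barrier** (route `CongruenceTowerPacking`, support item
`stmt-MatrixMultiplication-12344`, decl `AnalyticBoxBarrier`): TPP triples of first-order boxes
`gᵢ(1 + p^m Dᵢ(·))` in `GL_n(ℤ/p^k)`, `m < k ≤ 2m`, with conjugated tangents in a `d`-generated
submodule satisfy `|S| |T| |U| ≤ p^((k − m) d)`. Cohn–Umans 2003, Lemma 3.1 (injectivity of the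
product map of a TPP triple in an abelian group) after right translation into the abelian
congruence layer `1 + p^m M_n(ℤ/p^k)`. -/
theorem analyticBoxBarrier_proof : Theses.CongruenceTowerPacking.AnalyticBoxBarrier := by
  intro p k m n a b c d hp hmk hk2m g₁ g₂ g₃ D₁ D₂ D₃ gen hD₁ hD₂ hD₃ S T U hS hT hU tpp
  classical
  -- `π = p^m` squares to zero in `ℤ/p^k`
  set π : ZMod (p ^ k) := (p : ZMod (p ^ k)) ^ m with hπdef
  have hπ : π * π = 0 := by
    rw [hπdef, ← pow_add, ← Nat.cast_pow, ZMod.natCast_eq_zero_iff]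
    exact pow_dvd_pow p (by omega)
  -- the finite set containing `π L`
  obtain ⟨box, hbox_card, hmem_box⟩ :=
    box_count (M := Matrix (Fin n) (Fin n) (ZMod (p ^ k))) hp hmk.le gen
  -- the injection `(s, t, u) ↦ N₁ s + N₂ t + N₃ u`
  obtain ⟨Φ, hΦ⟩ : ∃ Φ : Matrix.GeneralLinearGroup (Fin n) (ZMod (p ^ k)) ×
      Matrix.GeneralLinearGroup (Fin n) (ZMod (p ^ k)) ×
        Matrix.GeneralLinearGroup (Fin n) (ZMod (p ^ k)) → Matrix (Fin n) (Fin n) (ZMod (p ^ k)),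
      ∀ x, Φ x = ((x.1 : Matrix (Fin n) (Fin n) (ZMod (p ^ k))) * g₁⁻¹.val - 1) +
        ((x.2.1 : Matrix (Fin n) (Fin n) (ZMod (p ^ k))) * g₂⁻¹.val - 1) +
        ((x.2.2 : Matrix (Fin n) (Fin n) (ZMod (p ^ k))) * g₃⁻¹.val - 1) :=
    ⟨_, fun _ => rfl⟩
  have hΦ_mem : ∀ x ∈ S ×ˢ T ×ˢ U, Φ x ∈ box := by
    rintro ⟨s, t, u⟩ hx
    simp only [Finset.mem_product] at hx
    obtain ⟨hs, ht, hu⟩ := hx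
    obtain ⟨x, hx⟩ := hS s hs
    obtain ⟨y, hy⟩ := hT t ht
    obtain ⟨z, hz⟩ := hU u hu
    rw [hΦ, tangent_eq g₁ s _ hx, tangent_eq g₂ t _ hy, tangent_eq g₃ u _ hz, ← smul_add,
      ← smul_add]
    exact hmem_box _ (Submodule.add_mem _ (Submodule.add_mem _ (hD₁ x) (hD₂ y)) (hD₃ z))
  have hΦ_inj : Set.InjOn Φ ↑(S ×ˢ T ×ˢ U) := by
    rintro ⟨s, t, u⟩ hx ⟨s', t', u'⟩ hx' he
    simp only [Finset.coe_product, Set.mem_prod, Finset.mem_coe] at hx hx'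
    obtain ⟨hs, ht, hu⟩ := hx
    obtain ⟨hs', ht', hu'⟩ := hx'
    obtain ⟨x, hx⟩ := hS s hs
    obtain ⟨x', hx'⟩ := hS s' hs'
    obtain ⟨y, hy⟩ := hT t ht
    obtain ⟨y', hy'⟩ := hT t' ht'
    obtain ⟨z, hz⟩ := hU u hu
    obtain ⟨z', hz'⟩ := hU u' hu'
    -- the hypothesis `Φ (s,t,u) = Φ (s',t',u')` in tangent form
    rw [hΦ, hΦ] at he
    simp only at he
    rw [tangent_eq g₁ s _ hx, tangent_eq g₂ t _ hy, tangent_eq g₃ u _ hz,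
      tangent_eq g₁ s' _ hx', tangent_eq g₂ t' _ hy', tangent_eq g₃ u' _ hz'] at he
    have key : s * s'⁻¹ * (t * t'⁻¹) * (u * u'⁻¹) = 1 := by
      apply Units.ext
      rw [Units.val_mul, Units.val_mul, quot_eq hπ g₁ s s' _ _ hx hx', quot_eq hπ g₂ t t' _ _ hy hy',
        quot_eq hπ g₃ u u' _ _ hz hz', Units.val_one,
        one_add_mul_one_add_mul_one_add (smul_mul_smul_eq_zero' hπ _ _)
          (smul_mul_smul_eq_zero' hπ _ _) (smul_mul_smul_eq_zero' hπ _ _),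
        smul_sub, smul_sub, smul_sub, add_eq_left]
      rw [← sub_eq_zero] at he
      rw [← he]
      abel
    obtain ⟨rfl, rfl, rfl⟩ := tpp s hs s' hs' t ht t' ht' u hu u' hu' key
    rfl
  calc S.card * T.card * U.card = (S ×ˢ T ×ˢ U).card := by
        rw [Finset.card_product, Finset.card_product, mul_assoc]
    _ = ((S ×ˢ T ×ˢ U).image Φ).card := (Finset.card_image_of_injOn hΦ_inj).symm
    _ ≤ box.card := Finset.card_le_card (Finset.image_subset_iff.mpr hΦ_mem)
    _ ≤ p ^ ((k - m) * d) := hbox_card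

end Summit.MatrixMultiplication.MatrixMultiplication.Theorems
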